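import Summits.BirchSwinnertonDyer.BirchSwinnertonDyer.Theorems.AdditiveBranchIMCGordTwoRankOneWanAnyRoadDefs
import HarnessLib

/-!
# Crux `AdditiveBranchIMC.GordTwoRankOne` (stmt-BirchSwinnertonDyer-19358), line `wan_tame_bdp_road` v23: the two M stubs BY NAME AND SIGNATURE
# — `stub_rootNumberDyadicWan : EngineTwo` and `stub_fieldOneDyadicWan : EngineTwo → FieldOneTwo`

Theorems only (no definition, no named fact, no `sorry`). The registered stubs E2 (i) and E2 (ii) of the skeleton
`Cruxes/GordTwoRankOne/Lines/wan_tame_bdp_road.lean` v23 (registry sha 1919872487cf), proved verbatim over the Theorems-side copies `WanAnyRoad.EngineTwo` /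
`WanAnyRoad.FieldOneTwo` of the line vocabulary (`AdditiveBranchIMCGordTwoRankOneWanAnyRoadDefs`; bodies byte-identical to the skeleton's l.338 / l.360):

* `stub_rootNumberDyadicWan : EngineTwo` — the root-number engine `w(E^{(2ℓ)}) = w(E)` at a NON-SPLIT multiplicative `2` (`ℓ ≡ 1 (mod 8)` good `≥ 5`,
  `(2ℓ/r) = 1` at the odd bad `r`): `TwistRootNumberDyadic.rootNumber_quadraticTwist_two_mul_eq_of_nonsplit_two` (p777009; modular road — the newform of
  `E^{(2ℓ)}` is `(f_E ⊗ χ_ℓ) ⊗ χ₈` at level `(M₀ℓ²)·8²`, `λ₂ = χ₈(−1) = 1` by the «any modulus» Atkin–Lehner law p762494, `λ_ℓ = χ₄(ℓ) = 1`, `λ₂(f_E) = +1` iff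
  `2` non-split; conductor half p776744);
* `stub_fieldOneDyadicWan : EngineTwo → FieldOneTwo` — the rank-one field supply with `2` RAMIFIED from the engine: `TwistRootNumberDyadic.fieldOneTwo_of_engineTwo`
  (p776858; Dirichlet prime `ℓ₁ ≡ 2 + 7M² (mod 8M)`, Hoffstein–Luo with the sign obstruction on `E^{(2ℓ₁)}`, `d_K = 8ℓ₁d` through the EVEN branch of
  `exists_heegnerField_iff_exists_fundamental`, `E^{(4m)} ≅ E^{(m)}`).

In the skeleton (whose `WanTameBdpRoad.EngineTwo` / `FieldOneTwo` are the same terms) the two sorries close by these names (δ-unfolding), or directly by the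
`TwistRootNumberDyadic` theorems. Seat prover-bsd-addord-stub-1-g0 (director-bsd (576)(A)(a) BENCH = GO). BSD is proved for no curve by any of this.
References: [Rohrlich1993Compositio] Prop. 2 (ii)–(iv), Prop. 3; [AtkinLi1978] §3; [AtkinLehner1970] §6; [HoffsteinLuo1997] Theorem (§1, pp. 435–436);
[FriedbergHoffstein1995] Thm. B.
-/

set_option autoImplicit false
set_option linter.dupNamespace false

namespace Summit.BirchSwinnertonDyer.BirchSwinnertonDyer.Theorems.WanAnyRoad

/-- **stub (rootNumberDyadicWan) — E2 (i)**: the root-number engine `EngineTwo` (`w(E^{(2ℓ)}) = w(E)` for NON-SPLIT multiplicative `2`, `ℓ ≡ 1 (mod 8)` good,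
`(2ℓ/r) = 1` at the odd bad `r`), by `TwistRootNumberDyadic.rootNumber_quadraticTwist_two_mul_eq_of_nonsplit_two`.
[cite: Rohrlich1993Compositio, Prop. 2 (ii)–(iv) and Prop. 3] [cite: AtkinLi1978, §3] -/
theorem stub_rootNumberDyadicWan : EngineTwo :=
  engineTwo_holds

/-- **stub (fieldOneDyadicWan) — E2 (ii)**: the field supply `FieldOneTwo` FROM the engine, by `TwistRootNumberDyadic.fieldOneTwo_of_engineTwo`.
[cite: HoffsteinLuo1997, Theorem (§1, pp. 435–436)] [cite: FriedbergHoffstein1995, Thm. B] -/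
theorem stub_fieldOneDyadicWan : EngineTwo → FieldOneTwo :=
  fieldOneTwo_of_engineTwo_holds

end Summit.BirchSwinnertonDyer.BirchSwinnertonDyer.Theorems.WanAnyRoad
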